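import Summits.FinalStateConjecture.FinalStateConjecture.Theorems.EIHFluxBalanceInertialRecessionStubPaintedVelocityKinematics

/-!
# Route EIHFluxBalance — `InertialRecession`, line `sublinear-is-free-clean-window-charges`:
# the kinematics conjunct of the slaving stub, and the reduction of `stub_slaving` to `SLAVED³`

Helper file for the crux `stmt-FinalStateConjecture-10166`
(`Summit.FinalStateConjecture.FinalStateConjecture.Theses.EIHFluxBalance.InertialRecession`),
registered stub `stub_slaving` (skeleton r11). The stub's conclusion is `SLAVED³ ∧ KINEMATICS`, where
KINEMATICS says that every painted lab velocity `vᵢ(t) = ((Λᵢ(t)e₀)⁰)⁻¹ (Λᵢ(t)e₀)~` is continuous and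
that `‖vᵢ(t)‖ ≤ k` for ALL `i, t` with one constant `0 ≤ k < 1`. This conjunct uses only two clauses of
the crux antecedent (Lorentz factors `|(Λᵢ(t)e₀)⁰| ≤ γ`; smoothness of the operator paths `Λᵢ`) and is
assembled here from the landed lemmas of `…StubPaintedVelocityKinematics`
(`continuous_labVelocity_of_contDiff_lorentz`, `norm_labVelocity_le_sqrt_max`,
`sqrt_one_sub_inv_max_sq_lt_one`; the constant is `k = √(1 − (max γ 1)⁻²)`, uniform in `t` because
`((Λe₀)⁰)² = 1 + ‖(Λe₀)~‖²` is an identity of `O(1,3)`):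

* `paintedVelocity_kinematics_forall` — KINEMATICS from the two clauses (all `t`, not only eventually);
* `paintedVelocity_kinematics_forall_slaving11` — its registered one-line carrier form;
* `stub_slaving_of_slaved3` — **reduction**: the registered statement of `stub_slaving` follows from its
  `SLAVED³` block alone (`antecedent → SLAVED³` for every instance implies `antecedent → SLAVED³ ∧ KINEMATICS`).

So the open content of `stub_slaving` is exactly the third-order slaving block `SLAVED³` (rates of
`uᵢ = Λᵢe₀` of orders `1–3`, of the centre mismatch `ξ̇ᵢ − v(Λᵢ)` of orders `0–2`, and of the axis
`Λᵢe₃` for `aᵢ ≠ 0`). O'Neill 1983, *Semi-Riemannian geometry*, Ch. 9, p. 233 (unit timelike vectors of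
`O(1,3)`). No definitions, no named facts.
-/

noncomputable section

-- the doubled `FinalStateConjecture.FinalStateConjecture` path component trips dupNamespace
set_option linter.dupNamespace false

namespace Summit.FinalStateConjecture.FinalStateConjecture.Theorems.SublinearIsFree.Slaving

open scoped BigOperators Topology Manifold Classical MeasureTheory Matrix InnerProductSpace ContDiff ENNReal
open Filter Set Function TopologicalSpace MeasureTheory Literature.Geometry.Lorentzian
open Summit.FinalStateConjecture.FinalStateConjecture.Theorems

/-! ### The kinematics conjunct, for all lab times -/

/-- **KINEMATICS of the painted lab velocities, for all `t`.** If every painted Lorentz motion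
`Λᵢ : ℝ → O(1,3)` is smooth as an operator path and has Lorentz factor `|(Λᵢ(t)e₀)⁰| ≤ γ`, then every
painted lab velocity `t ↦ ((Λᵢ(t)e₀)⁰)⁻¹ (Λᵢ(t)e₀)~` is continuous and `‖vᵢ(t)‖ ≤ k := √(1 − (max γ 1)⁻²) < 1`
for all `i` and ALL `t` (`continuous_labVelocity_of_contDiff_lorentz`, `norm_labVelocity_le_sqrt_max`,
`sqrt_one_sub_inv_max_sq_lt_one`). O'Neill 1983, Ch. 9, p. 233. [folklore] -/
theorem paintedVelocity_kinematics_forall {N : ℕ} {Λ : Fin N → ℝ → lorentzGroup} {γ : ℝ}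
    (hγ : ∀ i t, |((Λ i t : E4 ≃L[ℝ] E4) (E4.basisVector 0)) 0| ≤ γ)
    (hsm : ∀ i, ContDiff ℝ ((⊤ : ℕ∞) : WithTop ℕ∞) (fun t ↦ ((Λ i t : E4 ≃L[ℝ] E4) : E4 →L[ℝ] E4))) :
    (∀ i : Fin N, Continuous (fun t ↦ (((((Λ i t : lorentzGroup) : E4 ≃L[ℝ] E4) (E4.basisVector 0)) 0)⁻¹ • E4.spatial (((Λ i t : lorentzGroup) : E4 ≃L[ℝ] E4) (E4.basisVector 0))))) ∧ (∃ k : ℝ, 0 ≤ k ∧ k < 1 ∧ ∀ (i : Fin N) (t : ℝ), ‖(((((Λ i t : lorentzGroup) : E4 ≃L[ℝ] E4) (E4.basisVector 0)) 0)⁻¹ • E4.spatial (((Λ i t : lorentzGroup) : E4 ≃L[ℝ] E4) (E4.basisVector 0)))‖ ≤ k) := by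
  obtain ⟨hk0, hk1⟩ := sqrt_one_sub_inv_max_sq_lt_one γ
  exact ⟨fun i ↦ continuous_labVelocity_of_contDiff_lorentz (hsm i), Real.sqrt (1 - ((max γ 1) ^ 2)⁻¹),
    hk0, hk1, fun i t ↦ norm_labVelocity_le_sqrt_max (Λ i t) (hγ i t)⟩

/-- **Registered one-line carrier form** (`paintedVelocity_kinematics_forall_slaving11`) of
`paintedVelocity_kinematics_forall`: the KINEMATICS conjunct of `stub_slaving` from the Lorentz-factor and
smoothness clauses, for all lab times. O'Neill 1983, Ch. 9, p. 233. [folklore] -/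
theorem paintedVelocity_kinematics_forall_slaving11 : open Literature.Geometry.Lorentzian in ∀ {N : ℕ} {Λ : Fin N → ℝ → lorentzGroup} {γ : ℝ}, (∀ i t, |((Λ i t : E4 ≃L[ℝ] E4) (E4.basisVector 0)) 0| ≤ γ) → (∀ i, ContDiff ℝ ((⊤ : ℕ∞) : WithTop ℕ∞) (fun t ↦ ((Λ i t : E4 ≃L[ℝ] E4) : E4 →L[ℝ] E4))) → (∀ i : Fin N, Continuous (fun t ↦ (((((Λ i t : lorentzGroup) : E4 ≃L[ℝ] E4) (E4.basisVector 0)) 0)⁻¹ • E4.spatial (((Λ i t : lorentzGroup) : E4 ≃L[ℝ] E4) (E4.basisVector 0))))) ∧ (∃ k : ℝ, 0 ≤ k ∧ k < 1 ∧ ∀ (i : Fin N) (t : ℝ), ‖(((((Λ i t : lorentzGroup) : E4 ≃L[ℝ] E4) (E4.basisVector 0)) 0)⁻¹ • E4.spatial (((Λ i t : lorentzGroup) : E4 ≃L[ℝ] E4) (E4.basisVector 0)))‖ ≤ k) :=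
  fun hγ hsm ↦ paintedVelocity_kinematics_forall hγ hsm

/-! ### Reduction of the registered stub to its `SLAVED³` block -/

/-- **`stub_slaving` reduces to `SLAVED³`.** If, for every instance of the crux antecedent, the third-order
slaving block `SLAVED³` holds (rates of orders `1–3` of `Λᵢe₀`, of orders `0–2` of the centre mismatch
`ξ̇ᵢ − ((Λᵢe₀)⁰)⁻¹(Λᵢe₀)~`, and of orders `1–3` of `Λᵢe₃` when `aᵢ ≠ 0`, all tending to `0`), then the full
registered statement of `stub_slaving` (`SLAVED³ ∧ KINEMATICS`, verbatim) holds: the kinematics conjunct is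
`paintedVelocity_kinematics_forall` applied to the Lorentz-factor and smoothness clauses of the antecedent.
[folklore] -/
theorem stub_slaving_of_slaved3
    (hS : ∀ (X : Type) [TopologicalSpace X] [ChartedSpace E3 X] [IsManifold (𝓡 3) ((⊤ : ℕ∞) : WithTop ℕ∞) X] [T2Space X] [SecondCountableTopology X] [ConnectedSpace X], ∀ D ∈ admissibleVacuumData X, ∀ 𝒟 : VacuumCauchyDevelopment D, 𝒟.IsMaximal → ∀ (N : ℕ) (M a rin : Fin N → ℝ) (Λ : Fin N → ℝ → lorentzGroup) (ξ : Fin N → ℝ → E3) (γ κ τ₀ : ℝ) (U : Opens E4) (Φ : U → 𝒟.carrier) (O : Set 𝒟.carrier), ((∀ i, Kerr.IsSubextremal (M i) (a i) ∧ Kerr.rMinus (M i) (a i) < rin i ∧ rin i < Kerr.rPlus (M i) (a i)) ∧ (∀ i t, |((Λ i t : E4 ≃L[ℝ] E4) (E4.basisVector 0)) 0| ≤ γ) ∧ (∀ i, ContDiff ℝ ((⊤ : ℕ∞) : WithTop ℕ∞) (ξ i) ∧ ContDiff ℝ ((⊤ : ℕ∞) : WithTop ℕ∞) (fun t ↦ ((Λ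 i t : E4 ≃L[ℝ] E4) : E4 →L[ℝ] E4))) ∧ (∀ i j, i ≠ j → Tendsto (fun t ↦ ‖ξ i t - ξ j t‖) atTop atTop) ∧ (0 < κ ∧ κ < 1 ∧ ∀ i, ∀ᶠ t in atTop, ‖ξ i t‖ ≤ κ ^ 2 * t) ∧ ({x : E4 | τ₀ < x 0 ∧ ∀ i, rin i < Kerr.radius (a i) (poincareInv (Λ i (x 0)) (E4.ofTimeSpace (x 0) (ξ i (x 0))) x)} ⊆ (U : Set E4)) ∧ let B : ModelBackground := ⟨U, fun x ↦ Minkowski.bilin + ∑ i, (boostedKerrBilin (Λ i (x 0)) (E4.ofTimeSpace (x 0) (ξ i (x 0))) (M i) (a i) x - Minkowski.bilin), fun x ↦ x 0, E4.spatialNorm⟩; ContMDiff 𝓘(ℝ, E4) (𝓡 4) ((⊤ : ℕ∞) : WithTop ℕ∞) Φ ∧ Topology.IsOpenEmbedding ((B.lateRegion τ₀).restrict Φ) ∧ Φ '' {x : U | τ₀ < x.1 0 ∧ ∀ i, Kerr.rPlus (M i) (a i) < Kerr.radius (a i) (poincareInv (Λ i (x.1 0)) (E4.ofTimeSpace (x.1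 0) (ξ i (x.1 0))) x.1)} ⊆ O ∧ Tendsto (fun t ↦ 𝒟.toSpacetime.deviationCk B Φ 3 t) atTop (𝓝 0) ∧ Tendsto (fun t : ℝ ↦ ⨆ x ∈ {x : U | x.1 0 = t ∧ E4.spatialNorm x.1 ≤ κ * t}, ⨆ (m : ℕ) (_ : m ≤ 3), ENNReal.ofReal (1 + √(√((⨅ i, ‖E4.spatial x.1 - ξ i t‖) ^ 7))) * ‖iteratedFDeriv ℝ m (𝒟.toSpacetime.deviationExtend B Φ) x.1‖ₑ) atTop (𝓝 0) ∧ O = Summit.FinalStateConjecture.exteriorOf 𝒟.toCauchyDevelopment (Φ '' {x : U | τ₀ < x.1 0 ∧ ∀ i, Kerr.rPlus (M i) (a i) < Kerr.radius (a i) (poincareInv (Λ i (x.1 0)) (E4.ofTimeSpace (x.1 0) (ξ i (x.1 0))) x.1)}) ∧ ∀ t₁ : ℝ, τ₀ < t₁ → O \ Φ '' {x : U | t₁ < x.1 0 ∧ ∀ i, Kerr.rPlus (M i) (a i) < Kerr.radius (a i) (poincareInv (Λ i (x.1 0)) (E4.ofTimeSpace (x.1 0) (ξ i (x.1 0))) x.1)}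 ⊆ 𝒟.metric.causalPast 𝒟.timeOrientation (Φ '' {x : U | x.1 0 = t₁ ∧ ∀ i, Kerr.rPlus (M i) (a i) < Kerr.radius (a i) (poincareInv (Λ i (x.1 0)) (E4.ofTimeSpace (x.1 0) (ξ i (x.1 0))) x.1)})) →
      (∀ i : Fin N, (∀ m : ℕ, 1 ≤ m → m ≤ 3 → Tendsto (fun t ↦ iteratedDeriv m (fun s ↦ (((Λ i s : lorentzGroup) : E4 ≃L[ℝ] E4) (E4.basisVector 0))) t) atTop (𝓝 0)) ∧ (∀ m : ℕ, m ≤ 2 → Tendsto (fun t ↦ iteratedDeriv m (fun s ↦ deriv (ξ i) s - (((((Λ i s : lorentzGroup) : E4 ≃L[ℝ] E4) (E4.basisVector 0)) 0)⁻¹ • E4.spatial (((Λ i s : lorentzGroup) : E4 ≃L[ℝ] E4) (E4.basisVector 0)))) t) atTop (𝓝 0)) ∧ (a i ≠ 0 → ∀ m : ℕ, 1 ≤ m → m ≤ 3 → Tendsto (fun t ↦ iteratedDeriv m (fun s ↦ (((Λ i s : lorentzGroup) : E4 ≃L[ℝ] E4) (E4.basisVector 3))) t) atTop (𝓝 0))))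 :
    ∀ (X : Type) [TopologicalSpace X] [ChartedSpace E3 X] [IsManifold (𝓡 3) ((⊤ : ℕ∞) : WithTop ℕ∞) X] [T2Space X] [SecondCountableTopology X] [ConnectedSpace X], ∀ D ∈ admissibleVacuumData X, ∀ 𝒟 : VacuumCauchyDevelopment D, 𝒟.IsMaximal → ∀ (N : ℕ) (M a rin : Fin N → ℝ) (Λ : Fin N → ℝ → lorentzGroup) (ξ : Fin N → ℝ → E3) (γ κ τ₀ : ℝ) (U : Opens E4) (Φ : U → 𝒟.carrier) (O : Set 𝒟.carrier), ((∀ i, Kerr.IsSubextremal (M i) (a i) ∧ Kerr.rMinus (M i) (a i) < rin i ∧ rin i < Kerr.rPlus (M i) (a i)) ∧ (∀ i t, |((Λ i t : E4 ≃L[ℝ] E4) (E4.basisVector 0)) 0| ≤ γ) ∧ (∀ i, ContDiff ℝ ((⊤ : ℕ∞) : WithTop ℕ∞) (ξ i) ∧ ContDiff ℝ ((⊤ : ℕ∞) : WithTop ℕ∞) (fun t ↦ ((Λ i t : E4 ≃L[ℝ] E4) : E4 →L[ℝ] E4))) ∧ (∀ i j, i ≠ j → Tendsto (fun t ↦ ‖ξ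 i t - ξ j t‖) atTop atTop) ∧ (0 < κ ∧ κ < 1 ∧ ∀ i, ∀ᶠ t in atTop, ‖ξ i t‖ ≤ κ ^ 2 * t) ∧ ({x : E4 | τ₀ < x 0 ∧ ∀ i, rin i < Kerr.radius (a i) (poincareInv (Λ i (x 0)) (E4.ofTimeSpace (x 0) (ξ i (x 0))) x)} ⊆ (U : Set E4)) ∧ let B : ModelBackground := ⟨U, fun x ↦ Minkowski.bilin + ∑ i, (boostedKerrBilin (Λ i (x 0)) (E4.ofTimeSpace (x 0) (ξ i (x 0))) (M i) (a i) x - Minkowski.bilin), fun x ↦ x 0, E4.spatialNorm⟩; ContMDiff 𝓘(ℝ, E4) (𝓡 4) ((⊤ : ℕ∞) : WithTop ℕ∞) Φ ∧ Topology.IsOpenEmbedding ((B.lateRegion τ₀).restrict Φ) ∧ Φ '' {x : U | τ₀ < x.1 0 ∧ ∀ i, Kerr.rPlus (M i) (a i) < Kerr.radius (a i) (poincareInv (Λ i (x.1 0)) (E4.ofTimeSpace (x.1 0) (ξ i (x.1 0))) x.1)} ⊆ O ∧ Tendsto (fun t ↦ 𝒟.toSpacetime.deviationCk B Φ 3 t)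 atTop (𝓝 0) ∧ Tendsto (fun t : ℝ ↦ ⨆ x ∈ {x : U | x.1 0 = t ∧ E4.spatialNorm x.1 ≤ κ * t}, ⨆ (m : ℕ) (_ : m ≤ 3), ENNReal.ofReal (1 + √(√((⨅ i, ‖E4.spatial x.1 - ξ i t‖) ^ 7))) * ‖iteratedFDeriv ℝ m (𝒟.toSpacetime.deviationExtend B Φ) x.1‖ₑ) atTop (𝓝 0) ∧ O = Summit.FinalStateConjecture.exteriorOf 𝒟.toCauchyDevelopment (Φ '' {x : U | τ₀ < x.1 0 ∧ ∀ i, Kerr.rPlus (M i) (a i) < Kerr.radius (a i) (poincareInv (Λ i (x.1 0)) (E4.ofTimeSpace (x.1 0) (ξ i (x.1 0))) x.1)}) ∧ ∀ t₁ : ℝ, τ₀ < t₁ → O \ Φ '' {x : U | t₁ < x.1 0 ∧ ∀ i, Kerr.rPlus (M i) (a i) < Kerr.radius (a i) (poincareInv (Λ i (x.1 0)) (E4.ofTimeSpace (x.1 0) (ξ i (x.1 0))) x.1)} ⊆ 𝒟.metric.causalPast 𝒟.timeOrientation (Φ '' {x : U | x.1 0 = t₁ ∧ ∀ i, Kerr.rPlus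 (M i) (a i) < Kerr.radius (a i) (poincareInv (Λ i (x.1 0)) (E4.ofTimeSpace (x.1 0) (ξ i (x.1 0))) x.1)})) →
    (∀ i : Fin N, (∀ m : ℕ, 1 ≤ m → m ≤ 3 → Tendsto (fun t ↦ iteratedDeriv m (fun s ↦ (((Λ i s : lorentzGroup) : E4 ≃L[ℝ] E4) (E4.basisVector 0))) t) atTop (𝓝 0)) ∧ (∀ m : ℕ, m ≤ 2 → Tendsto (fun t ↦ iteratedDeriv m (fun s ↦ deriv (ξ i) s - (((((Λ i s : lorentzGroup) : E4 ≃L[ℝ] E4) (E4.basisVector 0)) 0)⁻¹ • E4.spatial (((Λ i s : lorentzGroup) : E4 ≃L[ℝ] E4) (E4.basisVector 0)))) t) atTop (𝓝 0)) ∧ (a i ≠ 0 → ∀ m : ℕ, 1 ≤ m → m ≤ 3 → Tendsto (fun t ↦ iteratedDeriv m (fun s ↦ (((Λ i s : lorentzGroup) : E4 ≃L[ℝ] E4) (E4.basisVector 3))) t) atTop (𝓝 0))) ∧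
    ((∀ i : Fin N, Continuous (fun t ↦ (((((Λ i t : lorentzGroup) : E4 ≃L[ℝ] E4) (E4.basisVector 0)) 0)⁻¹ • E4.spatial (((Λ i t : lorentzGroup) : E4 ≃L[ℝ] E4) (E4.basisVector 0))))) ∧ (∃ k : ℝ, 0 ≤ k ∧ k < 1 ∧ ∀ (i : Fin N) (t : ℝ), ‖(((((Λ i t : lorentzGroup) : E4 ≃L[ℝ] E4) (E4.basisVector 0)) 0)⁻¹ • E4.spatial (((Λ i t : lorentzGroup) : E4 ≃L[ℝ] E4) (E4.basisVector 0)))‖ ≤ k)) := by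
  intro X _ _ _ _ _ _ D hD 𝒟 h𝒟 N M a rin Λ ξ γ κ τ₀ U Φ O h
  refine ⟨hS X D hD 𝒟 h𝒟 N M a rin Λ ξ γ κ τ₀ U Φ O h, ?_⟩
  obtain ⟨-, hγ, hsm, -⟩ := h
  exact paintedVelocity_kinematics_forall hγ fun i ↦ (hsm i).2

end Summit.FinalStateConjecture.FinalStateConjecture.Theorems.SublinearIsFree.Slaving

end
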